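import Summits.SmoothPoincare4.SmoothPoincare4.Theorems.EntropyRungChangGurskyYangStubSmoothRoundLimitChartDataAux
import Literature.Geometry.Riemannian.RicciFlowChartRmCovariantNorms
import Literature.Geometry.Riemannian.CurvatureDerivativeNormSq
import HarnessLib

/-!
# The scaled Ricci flow read in a chart, II: decay of the covariant Ricci derivatives
(stub `helper_scaledChart_data`, layer S4a of `stub_smoothRoundLimit`, line
`margerin-cone-hamilton-rails`, crux `EntropyRung.ChangGurskyYang`, item stmt-SmoothPoincare4-10834)

Along a Ricci flow `g(t)` of Riemannian metrics on `[0, T)` on a closed manifold with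
`4`-dimensional Euclidean model, with the roundness rates on `[t₀, T)` and the decay of the
covariant curvature derivatives `|∇^{k+1}Rm|²(t, ·) ≤ C'_k (T−t)^{δ'_k − k − 3}` near `T`, this file
assembles the CHART DATA of the scaled metrics `g̃ = g/(T−t)` needed for their smooth convergence
(Hamilton 1982, §14, Lemma 14.2 and §17; Topping 2006, Lemma 5.3.2 and the dictionary of p. 47):

* `curvDerivNormSq_decay_from` — the decay of `|∇^{k+1}Rm|²` holds from `t₀` on (continuity on
  the compact `M × [t₀, t']`, `IsRicciFlow.contMDiffOn_curvDerivNormSq`);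
* `abs_tcovIter_ric2_chartRep_le` — the components of `∇^{k+1}Ric` of the chart representative
  decay like `(T−t)^{δ'/2}` wherever `‖G_t(y)/(T−t)‖ ≤ Λ`: `|∇^{k+1}Ric|²_g ≤ n |∇^{k+1}Rm|²_g`
  (`IsMetricOn.tnormSq_tcovIter_ric2_le`), the chart dictionary `curvDerivNormSq_eq_chart` /
  `curvD_eq_tcovIter`, and components against the invariant norm, `|T_J| ≤ (Π_a g_{J_aJ_a})^{1/2}|T|`
  (`abs_apply_le_sqrt_prod_mul`), the `k + 3` metric factors `g_{ii} ≤ Λ|b_i|²(T−t)` supplying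
  exactly the power `(T−t)^{(k+3)/2}` that converts `(T−t)^{(δ'−k−3)/2}` into `(T−t)^{δ'/2}`
  (the scale invariance of the components of `∇^{k+1}Ric`);
* `helper_scaledChart_data` — the registered statement: the two-sided bounds
  (`scaledChartRep_twoSided`), the Einstein defect (`norm_ricAt_sub_smul_chartRep_le`) and the
  covariant Ricci derivatives, on a closed chart ball at every point.

## References

* R. S. Hamilton, *Three-manifolds with positive Ricci curvature*, J. Differential Geom. 17
  (1982) 255–306, §14, Lemma 14.2; §17, Thm. 17.6. [Hamilton1982]
* P. Topping, *Lectures on the Ricci flow*, LMS Lecture Note Series 325, CUP 2006, Lemma 5.3.2,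
  Thm. 3.3.1 and §5.3, proof of Thm. 5.3.1, (5.3.3), p. 47. [Topping2006]
-/

noncomputable section

-- every `Summit.SmoothPoincare4.SmoothPoincare4.…` name repeats the summit = sub-problem segment (D-0017 layout)
set_option linter.dupNamespace false

-- operator spaces of bilinear forms over the model space
set_option maxSynthPendingDepth 3

open Set Function Filter Real Module Metric
open scoped Manifold ContDiff Topology

namespace Summit.SmoothPoincare4.SmoothPoincare4.Theorems.MargerinRails

open Literature.Geometry.Riemannian
open Literature.Geometry.Lorentzian Literature.Geometry.Lorentzian.PseudoRiemannianMetric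
open Literature.Geometry.Lorentzian.MetricCoord

section ChartData

variable {M : Type*} [TopologicalSpace M] [ChartedSpace (EuclideanSpace ℝ (Fin 4)) M]
  [IsManifold (𝓡 4) ∞ M]
  {g : ℝ → PseudoRiemannianMetric (𝓡 4) ∞ (EuclideanSpace ℝ (Fin 4)) (TangentSpace (𝓡 4) : M → Type _)}
  {cov : ℝ → CovariantDerivative (𝓡 4) (EuclideanSpace ℝ (Fin 4)) (TangentSpace (𝓡 4) : M → Type _)}
  {T t₀ : ℝ}

/-! ### The decay of `|∇^{k+1}Rm|²` from `t₀` on -/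

/-- **The decay of `|∇^{k+1}Rm|²` holds from `t₀` on**: if
`|∇^{k+1}Rm|²(t, ·) ≤ C' (T−t)^{δ'−k−3}` on `M × [t', T)` for some `t' < T`, then, with another
constant `C'' ≥ 0`, on `M × [t₀, T)`: the function `(x, t) ↦ |∇^{k+1}Rm|²(t, x)` is continuous on
the compact `M × [t₀, t']` (`IsRicciFlow.contMDiffOn_curvDerivNormSq`), where `(T−t)^{δ'−k−3}` has
a positive minimum. [cite: Topping2006, Thm. 3.3.1] [cite: Topping2006, §5.3, p. 47] -/
theorem curvDerivNormSq_decay_from [CompactSpace M] (hflow : IsRicciFlow g cov (Ico 0 T))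
    (hR : ∀ t ∈ Ico 0 T, (g t).IsRiemannian) (ht₀ : t₀ ∈ Ico 0 T) {k : ℕ} {δ' C' t' : ℝ}
    (ht' : t' ∈ Ico 0 T)
    (hdec : ∀ t ∈ Ico t' T, ∀ x : M,
      curvDerivNormSq (𝓡 4) g (k + 1) t x ≤ C' * (T - t) ^ (δ' - k - 3)) :
    ∃ C'' : ℝ, 0 ≤ C'' ∧ ∀ t ∈ Ico t₀ T, ∀ x : M,
      curvDerivNormSq (𝓡 4) g (k + 1) t x ≤ C'' * (T - t) ^ (δ' - k - 3) := by
  have hT : 0 < T := ht₀.1.trans_lt ht₀.2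
  rcases le_or_gt t' t₀ with hle | hle
  · refine ⟨max C' 0, le_max_right _ _, fun t ht x ↦ (hdec t ⟨hle.trans ht.1, ht.2⟩ x).trans ?_⟩
    exact mul_le_mul_of_nonneg_right (le_max_left _ _) (rpow_nonneg (sub_pos.2 ht.2).le _)
  -- continuity on `M × [t₀, t']`
  have hS : UniqueDiffOn ℝ (Ico 0 T) := uniqueDiffOn_Ico 0 T
  have hS' : Ico 0 T ⊆ closure (interior (Ico 0 T)) := by
    rw [interior_Ico, closure_Ioo hT.ne]
    exact Ico_subset_Icc_self
  have hcont : ContinuousOn (fun p : M × ℝ ↦ curvDerivNormSq (𝓡 4) g (k + 1) p.2 p.1)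
      (univ ×ˢ Icc t₀ t') :=
    ((hflow.contMDiffOn_curvDerivNormSq hS hS' hR (k + 1)).continuousOn).mono
      (prod_mono Subset.rfl fun t ht ↦ ⟨ht₀.1.trans ht.1, ht.2.trans_lt ht'.2⟩)
  obtain ⟨B, hB⟩ := (isCompact_univ.prod isCompact_Icc).exists_bound_of_continuousOn hcont
  -- a positive lower bound of `(T − t)^{δ'−k−3}` on `[t₀, t']`
  have hpowcont : ContinuousOn (fun t : ℝ ↦ (T - t) ^ (δ' - k - 3)) (Icc t₀ t') :=
    ContinuousOn.rpow_const (continuousOn_const.sub continuousOn_id) fun t ht ↦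
      Or.inl (sub_pos.2 (ht.2.trans_lt ht'.2)).ne'
  obtain ⟨s, hs, hmin⟩ := isCompact_Icc.exists_isMinOn (nonempty_Icc.2 hle.le) hpowcont
  have hm : 0 < (T - s) ^ (δ' - k - 3) := rpow_pos_of_pos (sub_pos.2 (hs.2.trans_lt ht'.2)) _
  refine ⟨max (max C' 0) (max B 0 / (T - s) ^ (δ' - k - 3)),
    (le_max_right C' 0).trans (le_max_left _ _), fun t ht x ↦ ?_⟩
  have hTt : 0 < T - t := sub_pos.2 ht.2
  rcases le_or_gt t' t with htt' | htt'
  · calc curvDerivNormSq (𝓡 4) g (k + 1) t x ≤ C' * (T - t) ^ (δ' - k - 3) := hdec t ⟨htt', ht.2⟩ x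
      _ ≤ _ := mul_le_mul_of_nonneg_right ((le_max_left C' 0).trans (le_max_left _ _))
          (rpow_nonneg hTt.le _)
  · have htI : t ∈ Icc t₀ t' := ⟨ht.1, htt'.le⟩
    have hb := hB (x, t) ⟨mem_univ _, htI⟩
    rw [Real.norm_eq_abs] at hb
    have h1 : curvDerivNormSq (𝓡 4) g (k + 1) t x ≤ max B 0 :=
      (le_abs_self _).trans (hb.trans (le_max_left _ _))
    have h2 : (T - s) ^ (δ' - k - 3) ≤ (T - t) ^ (δ' - k - 3) := (isMinOn_iff.1 hmin) t htI
    calc curvDerivNormSq (𝓡 4) g (k + 1) t x ≤ max B 0 := h1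
      _ = max B 0 / (T - s) ^ (δ' - k - 3) * (T - s) ^ (δ' - k - 3) := (div_mul_cancel₀ _ hm.ne').symm
      _ ≤ max B 0 / (T - s) ^ (δ' - k - 3) * (T - t) ^ (δ' - k - 3) :=
          mul_le_mul_of_nonneg_left h2 (div_nonneg (le_max_right _ _) hm.le)
      _ ≤ _ := mul_le_mul_of_nonneg_right (le_max_right _ _) (rpow_nonneg hTt.le _)

/-! ### Components of `∇^{k+1}Ric` of the chart representative -/

/-- **The components of `∇^{k+1}Ric` of the chart representative decay like `(T−t)^{δ'/2}`**
(Topping 2006, p. 47, (5.3.3), with decay weights): if `|∇^{k+1}Rm|²(t, ·) ≤ C' (T−t)^{δ'−k−3}`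
on `M × [t₀, T)` and `‖G_t(y)/(T−t)‖ ≤ Λ` at a point `y` of the chart target at `z` and a time
`t ∈ [t₀, T)`, then every component of `∇^{k+1}Ric(G_t)` at `y` (basis `finBasis`) is at most
`(… )^{1/2} (T−t)^{δ'/2}`: `|∇^{k+1}Ric|²_g ≤ n|∇^{k+1}Rm|²_g = n · U_{k+1}(t, Φ y)`
(`IsMetricOn.tnormSq_tcovIter_ric2_le`, `curvDerivNormSq_eq_chart`, `curvD_eq_tcovIter`) and
`|T_J| ≤ (Π_a g_{J_aJ_a})^{1/2}|T|` with the `k + 3` factors `g_{ii} ≤ Λ (Σ|b_i|)² (T−t)`.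
[cite: Topping2006, §5.3, p. 47] [cite: Topping2006, Thm. 3.3.1] -/
theorem abs_tcovIter_ric2_chartRep_le (hR : ∀ t ∈ Ico 0 T, (g t).IsRiemannian)
    (ht₀ : t₀ ∈ Ico 0 T) {k : ℕ} {δ' C' : ℝ} (hC' : 0 ≤ C')
    (hdec : ∀ t ∈ Ico t₀ T, ∀ x : M,
      curvDerivNormSq (𝓡 4) g (k + 1) t x ≤ C' * (T - t) ^ (δ' - k - 3))
    (z : M) {y : EuclideanSpace ℝ (Fin 4)} (hy : y ∈ (extChartAt (𝓡 4) z).target) {t : ℝ}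
    (ht : t ∈ Ico t₀ T) {Λ : ℝ} (hΛ : ‖(T - t)⁻¹ • chartRep (𝓡 4) g z t y‖ ≤ Λ)
    (J : Fin (k + 1) ⊕ Fin 2 → Fin (finrank ℝ (EuclideanSpace ℝ (Fin 4)))) :
    |tcovIter (chartRep (𝓡 4) g z t) (finBasis ℝ (EuclideanSpace ℝ (Fin 4))) (k + 1)
        (ric2 (chartRep (𝓡 4) g z t) (finBasis ℝ (EuclideanSpace ℝ (Fin 4)))) y J| ≤
      Real.sqrt ((Λ * (∑ i, ‖finBasis ℝ (EuclideanSpace ℝ (Fin 4)) i‖) ^ 2) ^ (k + 3) *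
        (Fintype.card (Fin (finrank ℝ (EuclideanSpace ℝ (Fin 4)))) * C')) * (T - t) ^ (δ' / 2) := by
  classical
  set b := finBasis ℝ (EuclideanSpace ℝ (Fin 4)) with hb
  set β : ℝ := ∑ i, ‖b i‖ with hβ
  set G := chartRep (𝓡 4) g z t with hG
  have hβ0 : 0 ≤ β := Finset.sum_nonneg fun i _ ↦ norm_nonneg (b i)
  have hTt : 0 < T - t := sub_pos.2 ht.2
  have ht' : t ∈ Ico 0 T := ⟨ht₀.1.trans ht.1, ht.2⟩
  have hΛ0 : 0 ≤ Λ := (norm_nonneg _).trans hΛ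
  have hGm : IsMetricOn G (extChartAt (𝓡 4) z).target := isMetricOn_chartRep g z t
  have hsy := hGm.symm y hy
  have hposy : ∀ v, v ≠ 0 → 0 < G y v v := fun v hv ↦ chartRep_pos (hR t ht') z ⟨y, hy⟩ v hv
  -- the decay of `|∇^{k+1}Rm|²` at `Φ y`, read in the chart at `z`
  have hU : tnormSq G b (tcovIter G b (k + 1) (rm4 G b)) y ≤ C' * (T - t) ^ (δ' - k - 3) := by
    have hsrc : (extChartAt (𝓡 4) z).symm y ∈ (extChartAt (𝓡 4) z).source :=
      (extChartAt (𝓡 4) z).map_target hy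
    have h1 := hdec t ht ((extChartAt (𝓡 4) z).symm y)
    rw [curvDerivNormSq_eq_chart (hR t ht') hsrc (k + 1), (extChartAt (𝓡 4) z).right_inv hy,
      curvD_eq_tcovIter, tnormSq_treindex] at h1
    exact h1
  -- `|∇^{k+1}Ric|² ≤ n |∇^{k+1}Rm|²`
  have hric : tnormSq G b (tcovIter G b (k + 1) (ric2 G b)) y ≤
      Fintype.card (Fin (finrank ℝ (EuclideanSpace ℝ (Fin 4)))) * (C' * (T - t) ^ (δ' - k - 3)) :=
    (hGm.tnormSq_tcovIter_ric2_le hy hposy (k + 1)).trans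
      (mul_le_mul_of_nonneg_left hU (Nat.cast_nonneg _))
  -- the metric factors `g_{ii} ≤ Λ β² (T − t)`
  have happ : ∀ v w : EuclideanSpace ℝ (Fin 4), ((T - t)⁻¹ • G y) v w = (T - t)⁻¹ * G y v w :=
    fun v w ↦ by simp only [_root_.smul_apply, smul_eq_mul]
  have hdiag : ∀ i, G y (b i) (b i) ≤ Λ * β ^ 2 * (T - t) := by
    intro i
    have hbi : ‖b i‖ ≤ β := Finset.single_le_sum (fun j _ ↦ norm_nonneg (b j)) (Finset.mem_univ i)
    have h1 := abs_apply₂_le ((T - t)⁻¹ • G y) (b i) (b i)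
    rw [happ, abs_mul, abs_of_pos (inv_pos.2 hTt), abs_of_pos (hposy _ (b.ne_zero i)),
      inv_mul_le_iff₀ hTt] at h1
    have h3 : ‖(T - t)⁻¹ • G y‖ * ‖b i‖ * ‖b i‖ ≤ Λ * β * β :=
      mul_le_mul (mul_le_mul hΛ hbi (norm_nonneg _) hΛ0) hbi (norm_nonneg _) (mul_nonneg hΛ0 hβ0)
    calc G y (b i) (b i) ≤ (T - t) * (‖(T - t)⁻¹ • G y‖ * ‖b i‖ * ‖b i‖) := h1
      _ ≤ (T - t) * (Λ * β * β) := mul_le_mul_of_nonneg_left h3 hTt.le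
      _ = Λ * β ^ 2 * (T - t) := by ring
  have hprod : ∏ a, G y (b (J a)) (b (J a)) ≤ (Λ * β ^ 2 * (T - t)) ^ (k + 3) := by
    calc ∏ a, G y (b (J a)) (b (J a)) ≤ ∏ _a : Fin (k + 1) ⊕ Fin 2, Λ * β ^ 2 * (T - t) :=
          Finset.prod_le_prod (fun a _ ↦ (hposy _ (b.ne_zero _)).le) fun a _ ↦ hdiag _
      _ = (Λ * β ^ 2 * (T - t)) ^ (k + 3) := by
          rw [Finset.prod_const, Finset.card_univ, Fintype.card_sum, Fintype.card_fin,
            Fintype.card_fin]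
  have h1 := abs_apply_le_sqrt_prod_mul b hsy hposy (tcovIter G b (k + 1) (ric2 G b)) J
  -- bookkeeping of the powers of `T − t`
  have hpq : (T - t) ^ (k + 3) * (T - t) ^ (δ' - k - 3) = (T - t) ^ δ' := by
    rw [← rpow_natCast (T - t) (k + 3), ← rpow_add hTt]
    congr 1
    push_cast
    ring
  have hsq : Real.sqrt ((T - t) ^ δ') = (T - t) ^ (δ' / 2) := by
    rw [sqrt_eq_rpow, ← rpow_mul hTt.le]
    congr 1
    ring
  have hA0 : 0 ≤ (Λ * β ^ 2 * (T - t)) ^ (k + 3) := pow_nonneg (by positivity) _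
  have hK0 : 0 ≤ (Λ * β ^ 2) ^ (k + 3) * (Fintype.card (Fin (finrank ℝ (EuclideanSpace ℝ (Fin 4)))) * C') :=
    by positivity
  calc |tcovIter G b (k + 1) (ric2 G b) y J|
      ≤ Real.sqrt (∏ a, G y (b (J a)) (b (J a))) *
          Real.sqrt (tnormSq G b (tcovIter G b (k + 1) (ric2 G b)) y) := h1
    _ ≤ Real.sqrt ((Λ * β ^ 2 * (T - t)) ^ (k + 3)) *
          Real.sqrt (Fintype.card (Fin (finrank ℝ (EuclideanSpace ℝ (Fin 4)))) *
            (C' * (T - t) ^ (δ' - k - 3))) :=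
        mul_le_mul (Real.sqrt_le_sqrt hprod) (Real.sqrt_le_sqrt hric) (Real.sqrt_nonneg _)
          (Real.sqrt_nonneg _)
    _ = Real.sqrt ((Λ * β ^ 2) ^ (k + 3) *
          (Fintype.card (Fin (finrank ℝ (EuclideanSpace ℝ (Fin 4)))) * C') * (T - t) ^ δ') := by
        rw [← Real.sqrt_mul hA0]
        congr 1
        rw [mul_pow, ← hpq]
        ring
    _ = Real.sqrt ((Λ * β ^ 2) ^ (k + 3) *
          (Fintype.card (Fin (finrank ℝ (EuclideanSpace ℝ (Fin 4)))) * C')) * (T - t) ^ (δ' / 2) := by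
        rw [Real.sqrt_mul hK0, hsq]

end ChartData

/-! ### The registered helper -/

/-- **HELPER `helper_scaledChart_data` — the chart data of the scaled metrics `g/(T−t)` near the
singular time** (layer S4a of `stub_smoothRoundLimit`; Hamilton 1982, §14, Lemma 14.2 and §17 read
in charts, Topping 2006, Lemma 5.3.2 and the dictionary of p. 47). Along a Ricci flow of
Riemannian metrics on `[0, T)` on a closed 4-manifold with the roundness rates on `[t₀, T)` and the
decay `|∇^{k+1}Rm|² ≤ C'_k (T−t)^{δ'_k−k−3}` near `T`, every point `z` has a closed chart ball
`B̄(ẑ, r) ⊆ target` on which, for `t ∈ [t₀, T)`: (i) `λ|v|² ≤ G_t(y)(v,v)/(T−t)` and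
`‖G_t(y)/(T−t)‖ ≤ Λ` (`scaledChartRep_twoSided`); (ii) the Einstein defect
`‖Ric(G_t)(y) − G_t(y)/(2(T−t))‖ ≤ C₀ (T−t)^δ` (`norm_ricAt_sub_smul_chartRep_le`); (iii) for every
`k`, the components of `∇^{k+1}Ric(G_t)` decay like `(T−t)^{δ'_k/2}`
(`curvDerivNormSq_decay_from`, `abs_tcovIter_ric2_chartRep_le`).
[cite: Hamilton1982, §14, Lemma 14.2] [cite: Topping2006, Lemma 5.3.2] [cite: Topping2006, §5.3, p. 47] -/
theorem helper_scaledChart_data : ∀ (M : Type) [TopologicalSpace M] [T2Space M] [SecondCountableTopology M] [ChartedSpace (EuclideanSpace ℝ (Fin 4)) M] [IsManifold (𝓡 4) ∞ M] [CompactSpace M] (g : ℝ → PseudoRiemannianMetric (𝓡 4) ∞ (EuclideanSpace ℝ (Fin 4)) (TangentSpace (𝓡 4) : M → Type _)) (cov : ℝ → CovariantDerivative (𝓡 4) (EuclideanSpace ℝ (Fin 4)) (TangentSpace (𝓡 4) : M → Type _)) (T : ℝ), 0 < T → IsRicciFlow g cov (Ico 0 T) → (∀ t ∈ Ico 0 T,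 (g t).IsRiemannian) → ∀ (δ C t₀ : ℝ), 0 < δ → t₀ ∈ Ico 0 T → (∀ t ∈ Ico t₀ T, ∀ x : M, |(T - t) * (g t).scalarCurvatureWith (cov t) x - 2| ≤ C * (T - t) ^ δ ∧ (T - t) ^ 2 * ((g t).normSq x ((cov t).ricci x) - (g t).scalarCurvatureWith (cov t) x ^ 2 / 4) ≤ C * (T - t) ^ (2 * δ) ∧ (T - t) ^ 2 * ((g t).curvNormSqWith (cov t) x - 2 * (g t).normSq x ((cov t).ricci x) + (g t).scalarCurvatureWith (cov t) x ^ 2 / 3) ≤ C * (T - t) ^ δ) → (∀ k : ℕ, ∃ δ' C' t' : ℝ, 0 < δ' ∧ t' ∈ Ico 0 T ∧ ∀ t ∈ Ico t' T, ∀ x : M, curvDerivNormSq (𝓡 4) g (k + 1) t x ≤ C' * (T - t) ^ (δ' - k - 3)) → ∀ z : M, ∃ r t₁ lam Λ : ℝ, 0 < r ∧ t₁ ∈ Ico 0 T ∧ 0 < lam ∧ Metric.closedBall (extChartAt (𝓡 4) z z) r ⊆ (extChartAt (𝓡 4) z).target ∧ (∀ t ∈ Ico t₁ T, ∀ y ∈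 Metric.closedBall (extChartAt (𝓡 4) z z) r, (∀ v : EuclideanSpace ℝ (Fin 4), lam * ‖v‖ ^ 2 ≤ (T - t)⁻¹ * chartRep (𝓡 4) g z t y v v) ∧ ‖(T - t)⁻¹ • chartRep (𝓡 4) g z t y‖ ≤ Λ) ∧ (∃ δ₀ C₀ : ℝ, 0 < δ₀ ∧ ∀ t ∈ Ico t₁ T, ∀ y ∈ Metric.closedBall (extChartAt (𝓡 4) z z) r, ‖MetricCoord.ricAt (chartRep (𝓡 4) g z t) y - (2 * (T - t))⁻¹ • chartRep (𝓡 4) g z t y‖ ≤ C₀ * (T - t) ^ δ₀) ∧ (∀ k : ℕ, ∃ δk Ck : ℝ, 0 < δk ∧ ∀ t ∈ Ico t₁ T, ∀ y ∈ Metric.closedBall (extChartAt (𝓡 4) z z) r, ∀ J : Fin (k + 1) ⊕ Fin 2 → Fin (Module.finrank ℝ (EuclideanSpace ℝ (Fin 4))), |MetricCoord.tcovIter (chartRep (𝓡 4) g z t) (Module.finBasis ℝ (EuclideanSpace ℝ (Fin 4))) (k + 1) (MetricCoord.ric2 (chartRep (𝓡 4) g z t) (Module.finBasis ℝ (EuclideanSpace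 ℝ (Fin 4)))) y J| ≤ Ck * (T - t) ^ δk) := by
  intro M _ _ _ _ _ _ g cov T hT hflow hR δ C t₀ hδ ht₀ hrate hdec z
  have hrate₂ : ∀ t ∈ Ico t₀ T, ∀ x : M,
      |(T - t) * (g t).scalarCurvatureWith (cov t) x - 2| ≤ C * (T - t) ^ δ ∧
      (T - t) ^ 2 * ((g t).normSq x ((cov t).ricci x) -
        (g t).scalarCurvatureWith (cov t) x ^ 2 / 4) ≤ C * (T - t) ^ (2 * δ) :=
    fun t ht x ↦ ⟨(hrate t ht x).1, (hrate t ht x).2.1⟩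
  -- a closed chart ball inside the (open) chart target
  obtain ⟨ε, hε, hball⟩ := Metric.isOpen_iff.mp (isOpen_extChartAt_target (I := 𝓡 4) z)
    (extChartAt (𝓡 4) z z) (mem_extChartAt_target z)
  have hr : 0 < ε / 2 := half_pos hε
  have hcl : closedBall (extChartAt (𝓡 4) z z) (ε / 2) ⊆ (extChartAt (𝓡 4) z).target :=
    (closedBall_subset_ball (half_lt_self hε)).trans hball
  -- (i) the two-sided bounds
  obtain ⟨lam, Λ, hlam, hGb⟩ := scaledChartRep_twoSided hflow hR hδ ht₀ hrate₂ z hr.le hcl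
  refine ⟨ε / 2, t₀, lam, Λ, hr, ht₀, hlam, hcl, hGb, ?_, fun k ↦ ?_⟩
  · -- (ii) the Einstein defect
    refine ⟨δ, Real.sqrt (C ^ 2 + 4 * C) * Λ, hδ, fun t ht y hy ↦ ?_⟩
    exact norm_ricAt_sub_smul_chartRep_le hflow hR ht₀ hrate₂ z (hcl hy) ht (hGb t ht y hy).2
  · -- (iii) the covariant Ricci derivatives
    obtain ⟨δ', C', t', hδ', ht', hb⟩ := hdec k
    obtain ⟨C'', hC'', hb'⟩ := curvDerivNormSq_decay_from hflow hR ht₀ ht' hb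
    refine ⟨δ' / 2, Real.sqrt ((Λ * (∑ i, ‖finBasis ℝ (EuclideanSpace ℝ (Fin 4)) i‖) ^ 2) ^ (k + 3) *
      (Fintype.card (Fin (finrank ℝ (EuclideanSpace ℝ (Fin 4)))) * C'')), half_pos hδ',
      fun t ht y hy J ↦ ?_⟩
    exact abs_tcovIter_ric2_chartRep_le hR ht₀ hC'' hb' z (hcl hy) ht (hGb t ht y hy).2 J

end Summit.SmoothPoincare4.SmoothPoincare4.Theorems.MargerinRails

end
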